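import Literature.Probability.RandomPlanarGeometry.SLEKappaRhoLogGamma
import Literature.Probability.RandomPlanarGeometry.SLEKappaRhoTranslates
import Literature.Probability.RandomPlanarGeometry.SLEKappaRhoChainBounds
import Literature.Probability.RandomPlanarGeometry.LoewnerImageStepCircle
import Literature.Probability.RandomPlanarGeometry.RestrictionHullsRiemannProofs
import Literature.Analysis.Complex.KoebeDistortion
import Literature.Analysis.Complex.CauchyTaylorBall
import HarnessLib

/-!
# A jet control for `E_B` from three geometric controls of the hull (clearance, `Φ'_B(0) ≥ d_min`)

G. F. Lawler, O. Schramm, W. Werner, *Conformal restriction: the chordal case*, J. Amer. Math.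
Soc. **16** (2003) 917–955 (**[LSW]**), §8.4, proof of Lemma 8.9. The localisation of the local
martingale `M_t` ("`(M_t, t < T)` is a local martingale") needs, along the stopped path, UNIFORM
bounds for the jets of `log M_t`, i.e. a `SLEKappaRho.JetControl (starMap B_t) δ η R` with
constants depending only on the localisation level. This file derives such a control for an arc
`+`-hull `B` (the slid hulls `A_t − W_t` are such) from:

* a lower bound `d_min ≤ Φ'_B(0)`;
* CLEARANCE: the balls `B(x, 8r)`, `x ∈ [−R−3, 0]`, do not meet `B`.

Ingredients, all from the tree: the restriction map of a translate `B − x` is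
`z ↦ Φ_B(z + x) − E_B(x)` (`translateRMap`, uniqueness of restriction maps
`IsRestrictionMap.unique`), whence **`E_{B−x}(w) = E_B(w + x) − E_B(x)` on the symmetric domain**
(`starMap_translate_apply`); Koebe's injectivity of `E_{B−x}` on `B(0, 4r)` (`injOn_hullExt_ball`)
and the distortion theorem (`Literature.Analysis.Complex.norm_deriv_le_distortion`) give
`|E_B'| ≤ 2` near the segment; the Cauchy bound `norm_sub_le_mul_of_forall_mem_ball` gives the
Lipschitz control of `E_B'` off the axis; and on the axis `E_B'(x) = Φ'_{B−x}(0) ≥ Φ'_B(0) ≥ d_min`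
for `x ≤ 0` by the monotonicity of [LSW] (8.2) (`SLEKappaRho.hullDeriv_translate_le`, along the
Loewner chain of the arc hull, `exists_chain_of_isArcHull`).

* `SLEKappaRho.jetControl_of_controls` — **`JetControl (starMap B) (d_min/2) η R`** with
  `η = min (d_min r/320) 1`.

No named facts.
-/

noncomputable section

open Set Filter Metric Complex
open scoped Topology ComplexConjugate
open UpperHalfPlane (upperHalfPlaneSet)

namespace Literature.Probability.RandomPlanarGeometry

namespace SLEKappaRho

variable {B : Set ℂ}

/-! ### `E_{B−x}(w) = E_B(w + x) − E_B(x)` -/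

/-- Membership in the symmetric domain of a translate. [folklore] -/
theorem mem_symmDomain_translate_iff {x : ℝ} {w : ℂ} :
    w ∈ symmDomain (translate B x) ↔ w + x ∈ symmDomain B := by
  simp only [mem_symmDomain_iff, translate_eq_preimage, mem_preimage, map_add, conj_ofReal]

/-- **The reflected extension of the translate**: `E_{B−x}(w) = E_B(w + x) − E_B(x)` for every
real `x ∉ B` and `w` in the symmetric domain of `B − x` (uniqueness of restriction maps on
`ℍ ∖ (B − x)`, conjugation symmetry below the axis, continuity on the axis). [folklore] -/
theorem starMap_translate_apply (hB : IsStarHull B) {x : ℝ} (hx : (x : ℂ) ∉ B) {w : ℂ}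
    (hw : w ∈ symmDomain (translate B x)) :
    starMap (translate B x) w = starMap B (w + x) - starMap B x := by
  have hBx : IsStarHull (translate B x) := isStarHull_translate hB.isBoundedHull hx
  have hreal := starMap_ofReal_eq_re' hB hx
  -- above the axis: uniqueness of restriction maps
  have hpos : ∀ w : ℂ, 0 < w.im → w ∉ translate B x →
      starMap (translate B x) w = starMap B (w + x) - starMap B x := by
    intro w hwim hwB
    have hmem : w ∈ upperHalfPlaneSet \ translate B x := ⟨hwim, hwB⟩
    have huniq := IsRestrictionMap.unique hBx (isRestrictionMap_translateRMap' hB hx)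
      (isRestrictionMap_starRMap hBx) hmem
    rw [starMap_eq hBx, hullExt_of_mem_diff hmem, huniq, translateRMap_apply, starMap_eq hB,
      hullExt_of_mem_diff (add_mem_diff_of_mem hmem), ← starMap_eq hB, ← hreal]
  -- below the axis: conjugation symmetry
  have hneg : ∀ w : ℂ, w.im < 0 → w ∈ symmDomain (translate B x) →
      starMap (translate B x) w = starMap B (w + x) - starMap B x := by
    intro w hwim hwD
    have hcw : conj w ∈ symmDomain (translate B x) := conj_mem_symmDomain hwD
    have hcim : 0 < (conj w).im := by rw [conj_im]; linarith
    have h1 := hpos (conj w) hcim hcw.1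
    -- `E(conj w) = conj (E w)` for both hulls
    have e1 : starMap (translate B x) (conj w) = conj (starMap (translate B x) w) := by
      rw [starMap_eq hBx]; exact hullExt_conj hBx.isBoundedHull (isRestrictionMap_starRMap hBx) hwD
    have hwx : w + x ∈ symmDomain B := mem_symmDomain_translate_iff.1 hwD
    have e2 : starMap B (conj w + x) = conj (starMap B (w + x)) := by
      rw [show conj w + (x : ℂ) = conj (w + x) by rw [map_add, conj_ofReal], starMap_eq hB]
      exact hullExt_conj hB.isBoundedHull (isRestrictionMap_starRMap hB) hwx
    have e3 : conj (starMap B x) = starMap B x := by rw [hreal, conj_ofReal]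
    rw [e1, e2] at h1
    have := congrArg conj h1
    rw [conj_conj, map_sub, conj_conj, e3] at this
    exact this
  -- on the axis: continuity (both sides are holomorphic on the open symmetric domain)
  rcases lt_trichotomy w.im 0 with hlt | heq | hgt
  · exact hneg w hlt hw
  · have hopen : IsOpen (symmDomain (translate B x)) := isOpen_symmDomain hBx.isBoundedHull.isClosed
    have hseq : Tendsto (fun n : ℕ ↦ w + I * ((1 / ((n : ℝ) + 1) : ℝ) : ℂ)) atTop (𝓝 w) := by
      have h := ((tendsto_one_div_add_atTop_nhds_zero_nat (𝕜 := ℝ)))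
      have h' : Tendsto (fun n : ℕ ↦ ((1 / ((n : ℝ) + 1) : ℝ) : ℂ)) atTop (𝓝 0) := by
        have := (continuous_ofReal.tendsto 0).comp h
        rw [ofReal_zero] at this
        exact this
      have := (h'.const_mul I).const_add w
      simpa using this
    have hev : ∀ᶠ n : ℕ in atTop, w + I * ((1 / ((n : ℝ) + 1) : ℝ) : ℂ) ∈ symmDomain (translate B x) :=
      hseq (hopen.mem_nhds hw)
    have hcont₁ : ContinuousAt (starMap (translate B x)) w := by
      rw [starMap_eq hBx]; exact (differentiableAt_hullExt hBx.isBoundedHull (isRestrictionMap_starRMap hBx) hw).continuousAt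
    have hwx : w + x ∈ symmDomain B := mem_symmDomain_translate_iff.1 hw
    have hcont₂ : ContinuousAt (fun w ↦ starMap B (w + x) - starMap B x) w := by
      refine ContinuousAt.sub ?_ continuousAt_const
      have hd : DifferentiableAt ℂ (starMap B) (w + x) := by
        rw [starMap_eq hB]; exact differentiableAt_hullExt hB.isBoundedHull (isRestrictionMap_starRMap hB) hwx
      have h2 : ContinuousAt (fun v : ℂ ↦ v + (x : ℂ)) w := (continuous_id.add continuous_const).continuousAt
      have : ContinuousAt (starMap B ∘ fun v : ℂ ↦ v + (x : ℂ)) w := ContinuousAt.comp_of_eq hd.continuousAt h2 rfl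
      exact this
    have hlim₁ := hcont₁.tendsto.comp hseq
    have hlim₂ := hcont₂.tendsto.comp hseq
    have heqev : (starMap (translate B x) ∘ fun n : ℕ ↦ w + I * ((1 / ((n : ℝ) + 1) : ℝ) : ℂ)) =ᶠ[atTop]
        ((fun w ↦ starMap B (w + x) - starMap B x) ∘ fun n : ℕ ↦ w + I * ((1 / ((n : ℝ) + 1) : ℝ) : ℂ)) := by
      filter_upwards [hev] with n hn
      have him : 0 < (w + I * ((1 / ((n : ℝ) + 1) : ℝ) : ℂ)).im := by
        simp only [add_im, mul_im, I_re, ofReal_im, mul_zero, I_im, ofReal_re, one_mul, zero_add, heq]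
        positivity
      exact hpos _ him hn.1
    exact tendsto_nhds_unique (hlim₁.congr' heqev) hlim₂
  · exact hpos w hgt hw.1

/-- **`E_{B−x}'(w) = E_B'(w + x)`** on the symmetric domain of `B − x`. [folklore] -/
theorem deriv_starMap_translate_apply (hB : IsStarHull B) {x : ℝ} (hx : (x : ℂ) ∉ B) {w : ℂ}
    (hw : w ∈ symmDomain (translate B x)) :
    deriv (starMap (translate B x)) w = deriv (starMap B) (w + x) := by
  have hBx : IsStarHull (translate B x) := isStarHull_translate hB.isBoundedHull hx
  have hopen : IsOpen (symmDomain (translate B x)) := isOpen_symmDomain hBx.isBoundedHull.isClosed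
  have hev : starMap (translate B x) =ᶠ[𝓝 w] fun w ↦ starMap B (w + x) - starMap B x := by
    filter_upwards [hopen.mem_nhds hw] with v hv
    exact starMap_translate_apply hB hx hv
  rw [hev.deriv_eq, deriv_sub_const, deriv_comp_add_const]

/-! ### Koebe distortion on a ball -/

/-- **Koebe distortion on `B(c, ρ)`**: for `f` holomorphic and injective on the ball,
`|f'(z)| ≤ |f'(c)| (1 + θ)/(1 − θ)³`, `θ = |z − c|/ρ < 1`.
[cite: LawlerSchrammWerner2003Restriction, §8.4 (localisation of M_t); Pommerenke Thm. 1.3] -/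
theorem norm_deriv_le_distortion_ball {f : ℂ → ℂ} {c : ℂ} {ρ : ℝ} (hρ : 0 < ρ)
    (hf : DifferentiableOn ℂ f (ball c ρ)) (hinj : InjOn f (ball c ρ)) {z : ℂ} (hz : ‖z - c‖ < ρ) :
    ‖deriv f z‖ ≤ ‖deriv f c‖ * ((1 + ‖z - c‖ / ρ) / (1 - ‖z - c‖ / ρ) ^ 3) := by
  -- rescale to the unit ball
  set g : ℂ → ℂ := fun ζ ↦ f (c + (ρ : ℂ) * ζ) with hg
  have hmaps : ∀ ζ : ℂ, ‖ζ‖ < 1 → c + (ρ : ℂ) * ζ ∈ ball c ρ := by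
    intro ζ hζ
    rw [mem_ball, dist_eq_norm, add_sub_cancel_left, norm_mul, norm_real, Real.norm_eq_abs, abs_of_pos hρ]
    calc ρ * ‖ζ‖ < ρ * 1 := by gcongr
      _ = ρ := mul_one ρ
  have haff : ∀ ζ : ℂ, HasDerivAt (fun ζ : ℂ ↦ c + (ρ : ℂ) * ζ) (ρ : ℂ) ζ := fun ζ ↦ by
    simpa using ((hasDerivAt_id ζ).const_mul (ρ : ℂ)).const_add c
  have hgd : DifferentiableOn ℂ g (ball 0 1) := by
    intro ζ hζ
    have hζ' : ‖ζ‖ < 1 := by simpa using hζ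
    exact ((hf.differentiableAt (isOpen_ball.mem_nhds (hmaps ζ hζ'))).comp ζ
      (haff ζ).differentiableAt).differentiableWithinAt
  have hginj : InjOn g (ball 0 1) := by
    intro ζ₁ h₁ ζ₂ h₂ heq
    have h₁' : ‖ζ₁‖ < 1 := by simpa using h₁
    have h₂' : ‖ζ₂‖ < 1 := by simpa using h₂
    have := hinj (hmaps ζ₁ h₁') (hmaps ζ₂ h₂') heq
    have hρ0 : (ρ : ℂ) ≠ 0 := by exact_mod_cast hρ.ne'
    simpa [hρ0] using this
  have hgderiv : ∀ ζ : ℂ, ‖ζ‖ < 1 → deriv g ζ = deriv f (c + (ρ : ℂ) * ζ) * ρ := by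
    intro ζ hζ
    have hfd : HasDerivAt f (deriv f (c + (ρ : ℂ) * ζ)) (c + (ρ : ℂ) * ζ) :=
      (hf.differentiableAt (isOpen_ball.mem_nhds (hmaps ζ hζ))).hasDerivAt
    exact (hfd.comp ζ (haff ζ)).deriv
  set ζ₀ : ℂ := (z - c) / (ρ : ℂ) with hζ₀
  have hρ0 : (ρ : ℂ) ≠ 0 := by exact_mod_cast hρ.ne'
  have hζ₀n : ‖ζ₀‖ = ‖z - c‖ / ρ := by
    rw [hζ₀, norm_div, norm_real, Real.norm_eq_abs, abs_of_pos hρ]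
  have hζ₀1 : ‖ζ₀‖ < 1 := by rw [hζ₀n, div_lt_one hρ]; exact hz
  have hzeq : c + (ρ : ℂ) * ζ₀ = z := by rw [hζ₀]; field_simp; ring
  have hK := Literature.Analysis.Complex.AreaThm.norm_deriv_le_distortion hgd hginj hζ₀1
  rw [hgderiv ζ₀ hζ₀1, hgderiv 0 (by simp), hzeq, mul_zero, add_zero, norm_mul, norm_mul, norm_real,
    Real.norm_eq_abs, abs_of_pos hρ, hζ₀n] at hK
  have h := div_le_div_of_nonneg_right hK hρ.le
  rw [mul_div_assoc, div_self hρ.ne', mul_one] at h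
  calc ‖deriv f z‖ ≤ ‖deriv f c‖ * ρ * ((1 + ‖z - c‖ / ρ) / (1 - ‖z - c‖ / ρ) ^ 3) / ρ := h
    _ = ‖deriv f c‖ * ((1 + ‖z - c‖ / ρ) / (1 - ‖z - c‖ / ρ) ^ 3) := by field_simp

/-- The distortion factor is `≤ 2` for `θ ≤ 1/8`. [folklore] -/
theorem distortion_factor_le_two {θ : ℝ} (h1 : θ ≤ 1 / 8) : (1 + θ) / (1 - θ) ^ 3 ≤ 2 := by
  have h1θ : 0 < 1 - θ := by linarith
  have hpos : 0 < (1 - θ) ^ 3 := by positivity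
  rw [div_le_iff₀ hpos]
  nlinarith [sq_nonneg θ, mul_pos h1θ h1θ, mul_pos (mul_pos h1θ h1θ) h1θ]

/-! ### `|E_B'| ≤ 2` near a clear real point -/

section Clear

variable (hB : IsStarHull B) {x r : ℝ} (hr : 0 < r) (hclear : Disjoint (ball (x : ℂ) (8 * r)) B)
include hB hr hclear

omit hB in
/-- A clear real point is off the hull. [folklore] -/
theorem ofReal_notMem_of_clear : (x : ℂ) ∉ B :=
  Set.disjoint_left.1 hclear (mem_ball_self (by positivity))

omit hB hr in
/-- The translate `B − x` is clear of `B(0, 8r)`. [folklore] -/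
theorem disjoint_ball_translate : Disjoint (ball (0 : ℂ) (8 * r)) (translate B x) := by
  rw [Set.disjoint_left]
  intro w hw hwB
  rw [translate_eq_preimage, mem_preimage] at hwB
  refine Set.disjoint_left.1 hclear ?_ hwB
  rw [mem_ball, dist_eq_norm, add_sub_cancel_right]; simpa using hw

/-- **`|E_B'(z)| ≤ 2 E_B'(x)·𝟙 ≤ 2` on `B(x, r/2)`** for a clear real point `x` (Koebe distortion for
the univalent `E_{B−x}` on `B(0, 4r)`, `E_{B−x}' = E_B'(· + x)`, `0 < E_B'(x) ≤ 1`). [folklore] -/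
theorem norm_deriv_starMap_le_two {z : ℂ} (hz : z ∈ ball (x : ℂ) (r / 2)) : ‖deriv (starMap B) z‖ ≤ 2 := by
  have hxB := ofReal_notMem_of_clear hr hclear
  have hBx : IsStarHull (translate B x) := isStarHull_translate hB.isBoundedHull hxB
  have hT := disjoint_ball_translate hclear
  have hinj : InjOn (starMap (translate B x)) (ball (0 : ℂ) (4 * r)) := by
    rw [starMap_eq hBx]
    exact Loewner.injOn_hullExt_ball hBx (isRestrictionMap_starRMap hBx) (starDeriv_spec hBx).2.2 hr hT
  have hsub : ball (0 : ℂ) (4 * r) ⊆ symmDomain (translate B x) := by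
    have h := ball_subset_symmDomain (B := translate B x) (x := 0) (r := 8 * r) (by simpa using hT)
    rw [ofReal_zero] at h
    exact (ball_subset_ball (by linarith)).trans h
  have hdiff : DifferentiableOn ℂ (starMap (translate B x)) (ball (0 : ℂ) (4 * r)) := by
    rw [starMap_eq hBx]
    exact (differentiableOn_hullExt hBx.isBoundedHull (isRestrictionMap_starRMap hBx)).mono hsub
  -- distortion at `ζ = z − x`
  set ζ : ℂ := z - x with hζ
  have hζn : ‖ζ‖ < r / 2 := by rw [hζ]; simpa [mem_ball, dist_eq_norm] using hz
  have hζ4 : ‖ζ - 0‖ < 4 * r := by rw [sub_zero]; linarith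
  have hK := norm_deriv_le_distortion_ball (by positivity) hdiff hinj hζ4
  rw [sub_zero] at hK
  have hθ0 : 0 ≤ ‖ζ‖ / (4 * r) := by positivity
  have hθ1 : ‖ζ‖ / (4 * r) ≤ 1 / 8 := by
    rw [div_le_div_iff₀ (by positivity) (by norm_num)]; linarith
  have hfac := distortion_factor_le_two hθ1
  -- `E_{B−x}'(ζ) = E_B'(z)`, `E_{B−x}'(0) = Φ'_{B−x}(0) ≤ 1`
  have hζmem : ζ ∈ symmDomain (translate B x) := hsub (by rw [mem_ball, dist_zero_right]; linarith)
  have h0mem : (0 : ℂ) ∈ symmDomain (translate B x) := hsub (mem_ball_self (by positivity))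
  rw [deriv_starMap_translate_apply hB hxB hζmem, deriv_starMap_translate_apply hB hxB h0mem, zero_add,
    show ζ + (x : ℂ) = z by rw [hζ]; ring] at hK
  have hd1 : ‖deriv (starMap B) x‖ ≤ 1 := by
    have h := re_deriv_starMap_pos_le_one hB hxB
    rw [deriv_starMap_ofReal_eq_re hB hxB, norm_real, Real.norm_eq_abs, abs_of_pos h.1]
    exact h.2
  calc ‖deriv (starMap B) z‖ ≤ ‖deriv (starMap B) x‖ * ((1 + ‖ζ‖ / (4 * r)) / (1 - ‖ζ‖ / (4 * r)) ^ 3) := hK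
    _ ≤ 1 * 2 := mul_le_mul hd1 hfac (by
        have : 0 < (1 - ‖ζ‖ / (4 * r)) ^ 3 := by
          have : ‖ζ‖ / (4 * r) < 1 := by linarith
          positivity
        positivity) zero_le_one
    _ = 2 := one_mul 2

omit hr in
/-- `B(x, 8r)` lies in the symmetric domain, where `E_B` is holomorphic. [folklore] -/
theorem differentiableOn_starMap_ball : DifferentiableOn ℂ (starMap B) (ball (x : ℂ) (8 * r)) := by
  rw [starMap_eq hB]
  exact (differentiableOn_hullExt hB.isBoundedHull (isRestrictionMap_starRMap hB)).mono (ball_subset_symmDomain hclear)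

/-- **Lipschitz control of `E_B'` near a clear real point**: `|E_B'(z) − E_B'(x)| ≤ (40/r)|z − x|`
for `z ∈ B(x, r/10)` (Cauchy bound for `E_B''` from `|E_B'| ≤ 2` on `B(x, r/5)`). [folklore] -/
theorem norm_deriv_starMap_sub_le {z : ℂ} (hz : z ∈ ball (x : ℂ) (r / 10)) :
    ‖deriv (starMap B) z - deriv (starMap B) x‖ ≤ 40 / r * ‖z - x‖ := by
  have hdiff : DifferentiableOn ℂ (deriv (starMap B)) (ball (x : ℂ) (r / 5)) := by
    have h := differentiableOn_starMap_ball hB hclear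
    have h' : DifferentiableOn ℂ (deriv (starMap B)) (ball (x : ℂ) (8 * r)) :=
      ((h.analyticOnNhd isOpen_ball).deriv).differentiableOn
    exact h'.mono (ball_subset_ball (by linarith))
  have hM : ∀ w ∈ ball (x : ℂ) (r / 5), ‖deriv (starMap B) w‖ ≤ 2 := fun w hw ↦
    norm_deriv_starMap_le_two hB hr hclear (ball_subset_ball (by linarith) hw)
  have h := Literature.Analysis.Complex.norm_sub_le_mul_of_forall_mem_ball (by positivity : (0 : ℝ) < r / 5) hdiff hM
    (z := z) (w := x) (by convert hz using 2; ring) (mem_ball_self (by positivity))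
  calc _ ≤ 4 * 2 / (r / 5) * ‖z - (x : ℂ)‖ := h
    _ = 40 / r * ‖z - x‖ := by field_simp; ring

end Clear

/-! ### The jet control -/

/-- `|z − x₀| < 4η` for `z` in the box and `x₀ = min (re z) 0`. [folklore] -/
theorem norm_sub_min_re_lt {R η : ℝ} {z : ℂ} (hz : z ∈ jetBox R η) :
    ‖z - ((min z.re 0 : ℝ) : ℂ)‖ < 4 * η := by
  obtain ⟨⟨-, hz2⟩, hz3⟩ := hz
  have hre : |(z - ((min z.re 0 : ℝ) : ℂ)).re| < 2 * η := by
    simp only [sub_re, ofReal_re]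
    rcases le_or_gt z.re 0 with h | h
    · rw [min_eq_left h, sub_self, abs_zero]; linarith [abs_nonneg z.im]
    · rw [min_eq_right h.le, sub_zero, abs_of_pos h]; exact hz2
  have him : |(z - ((min z.re 0 : ℝ) : ℂ)).im| < 2 * η := by
    simp only [sub_im, ofReal_im, sub_zero]; exact hz3
  calc ‖z - ((min z.re 0 : ℝ) : ℂ)‖ ≤ |(z - ((min z.re 0 : ℝ) : ℂ)).re| + |(z - ((min z.re 0 : ℝ) : ℂ)).im| :=
        norm_le_abs_re_add_abs_im _
    _ < 2 * η + 2 * η := add_lt_add hre him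
    _ = 4 * η := by ring

/-- **A jet control from the geometric controls.** For an arc hull `B ∈ 𝒬₊` with
`d_min ≤ Φ'_B(0)` and the balls `B(x, 8r)`, `x ∈ [−R−3, 0]`, off `B`:
`JetControl (starMap B) (d_min/2) η R` with `η = min (d_min r / 320) 1`.
[cite: LawlerSchrammWerner2003Restriction, §8.4 proof of Lemma 8.9 (localisation)] -/
theorem jetControl_of_controls (hB : IsPlusHull B) (hBa : IsArcHull B) {dmin r R : ℝ} (hdmin : 0 < dmin)
    (hd : dmin ≤ starDeriv B) (hr : 0 < r) (hR : 0 ≤ R)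
    (hclear : ∀ x : ℝ, x ∈ Icc (-R - 3) 0 → Disjoint (ball (x : ℂ) (8 * r)) B) :
    JetControl (starMap B) (dmin / 2) (min (dmin * r / 320) 1) R := by
  have hst := hB.1
  set η : ℝ := min (dmin * r / 320) 1 with hη
  have hη0 : 0 < η := lt_min (by positivity) one_pos
  have hηle : η ≤ dmin * r / 320 := min_le_left _ _
  have hd1 : dmin ≤ 1 := hd.trans (starDeriv_spec hst).2.1
  have hηr : η ≤ r / 320 := hηle.trans (by
    rw [div_le_div_iff_of_pos_right (by norm_num : (0 : ℝ) < 320)]; nlinarith)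
  -- the base point of a box point
  have hbase : ∀ z ∈ jetBox R η, (min z.re 0 : ℝ) ∈ Icc (-R - 3) 0 := by
    intro z hz
    refine ⟨?_, min_le_right _ _⟩
    have := hz.1.1
    rcases le_or_gt z.re 0 with h | h
    · rw [min_eq_left h]; linarith
    · rw [min_eq_right h.le]; linarith
  -- box points are close to their base point, inside the clear balls
  have hnear : ∀ z ∈ jetBox R η, ‖z - ((min z.re 0 : ℝ) : ℂ)‖ < 4 * η := fun z hz ↦ norm_sub_min_re_lt hz
  have hdiffz : ∀ z ∈ jetBox R η, DifferentiableAt ℂ (starMap B) z := by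
    intro z hz
    have hcl := hclear _ (hbase z hz)
    refine (differentiableOn_starMap_ball hst hcl).differentiableAt (isOpen_ball.mem_nhds ?_)
    rw [mem_ball, dist_eq_norm]; linarith [hnear z hz]
  -- the Loewner chain of the arc hull (for the monotonicity of `x ↦ Φ'_{B−x}(0)`)
  obtain ⟨V, S, hV, -, hV0, hhull⟩ := exists_chain_of_isArcHull hBa hB
  refine
    { δ_pos := by positivity
      η_pos := hη0
      η_le_one := min_le_right _ _
      R_nonneg := hR
      differentiableOn := fun z hz ↦ (hdiffz z hz).differentiableWithinAt
      norm_deriv_le := fun z hz ↦ ?_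
      le_re_deriv := fun z hz ↦ ?_
      map_zero := starMap_zero hst
      im_ofReal := fun t ht ↦ ?_ }
  · -- `|E'| ≤ 2`
    have hcl := hclear _ (hbase z hz)
    refine norm_deriv_starMap_le_two hst hr hcl ?_
    rw [mem_ball, dist_eq_norm]; linarith [hnear z hz]
  · -- `Re E' ≥ d_min/2`
    set x₀ : ℝ := min z.re 0 with hx₀
    have hx₀I := hbase z hz
    have hcl := hclear _ hx₀I
    have hx₀B : (x₀ : ℂ) ∉ B := hB.ofReal_notMem_of_nonpos hx₀I.2
    have hlip := norm_deriv_starMap_sub_le hst hr hcl (z := z) (by rw [mem_ball, dist_eq_norm]; linarith [hnear z hz])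
    -- on the axis: `E'(x₀) = Φ'_{B−x₀}(0) ≥ Φ'_B(0) ≥ d_min`
    have hax : dmin ≤ (deriv (starMap B) x₀).re := by
      rw [← hullDeriv_translate hst hx₀B]
      have hmono := hullDeriv_translate_le hV hB hhull hV0 hx₀I.2 le_rfl
      rw [translate_zero, hullDeriv_eq_starDeriv] at hmono
      exact hd.trans hmono
    have hsmall : ‖deriv (starMap B) z - deriv (starMap B) x₀‖ ≤ dmin / 2 := by
      calc _ ≤ 40 / r * ‖z - x₀‖ := hlip
        _ ≤ 40 / r * (4 * η) := by gcongr; exact (hnear z hz).le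
        _ ≤ 40 / r * (4 * (dmin * r / 320)) := by gcongr
        _ = dmin / 2 := by field_simp; ring
    have hre : (deriv (starMap B) x₀).re - (deriv (starMap B) z).re ≤ dmin / 2 := by
      calc _ = (deriv (starMap B) x₀ - deriv (starMap B) z).re := by simp
        _ ≤ ‖deriv (starMap B) x₀ - deriv (starMap B) z‖ := re_le_norm _
        _ = ‖deriv (starMap B) z - deriv (starMap B) x₀‖ := norm_sub_rev _ _
        _ ≤ dmin / 2 := hsmall
    linarith
  · -- `E` is real on the real points of the box
    have htB : (t : ℂ) ∉ B := by
      rcases le_or_gt t 0 with h0 | h0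
      · exact hB.ofReal_notMem_of_nonpos h0
      · have hcl := hclear 0 ⟨by linarith, le_rfl⟩
        refine Set.disjoint_left.1 hcl ?_
        have ht2 : t < 2 * η := by have := ht.1.2; simpa using this
        rw [mem_ball, ofReal_zero, dist_zero_right, norm_real, Real.norm_eq_abs, abs_of_pos h0]
        linarith
    rw [starMap_ofReal_eq_re' hst htB, ofReal_im]

end SLEKappaRho

end Literature.Probability.RandomPlanarGeometry

end
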